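import Mathlib
import Summits.AtomisticToContinuum.HydrodynamicLimit.Theorems.InformationPercolationEngineKickFairRelEquilibriumMesoLongReduction
import Summits.AtomisticToContinuum.HydrodynamicLimit.Theorems.InformationPercolationEngineKickFairRelEquilibriumMesoLongWindowAtDefs
import HarnessLib

/-!
# `KickFairRelEquilibriumMeso`, line `kinetic-window-cut` (rev 5) — stub `mesoBodyAt_of_long`:
# the PER-PROFILE reduction `B1_at → U_at → TFL_at → MesoBody_at`

Prover file (`--supports stmt-AtomisticToContinuum-15177`, wave 2 of lead c8, worker W9) for the registered stub
`mesoBodyAt_of_long` of the line `kinetic-window-cut` (rev 5, the LONG-FLIGHT window cut) of the crux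
`Summit.AtomisticToContinuum.HydrodynamicLimit.Theses.InformationPercolationEngine.KickFairRelEquilibriumMeso`.

It is the landed GLOBAL reduction `mesoBody_of_long : SingleKickBias rs → ShortFlightLG → TruncatedFluctuationLong rs → MesoBody rs`
(`…MesoLongReduction`) re-proved at FIXED profiles `(a₀, θ₀, u₀)`, over the per-profile bodies `SingleKickBiasAt`, `ShortFlightLGAt`,
`TruncatedFluctuationLongAt`, `MesoBodyAt` of `…MesoLongWindowAtDefs` (each global statement is definitionally
`∀ profiles, hypotheses → …At`). The global proof already works profile by profile after its first four lines, so the argument is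
the same: given `Φ, τ, g (|g| ≤ C), δ` and admissible `h`, B1_at at `δ/3` (`N₁`), U_at at `δ/(3(4C+1))` (giving `A` and `N₂`),
TFL_at at `(A, δ/3)` (`N₃`); for `N ≥ max N₁ (max N₂ N₃)` split `S_h` by `lintegral_abs_fullSum_le_long` (with `tw = t_N`): the bias
term is B1_at's integrand, the short term is U_at's, and the long term `E_{LG}|(ε/(N+1)) ΣΣ h_L(P)(D − β)|` is bounded by `δ/3`
through Fatou in the truncation level (`lintegral_abs_mul_sum_le_of_trunc`): its level-`(M+1)` truncation is TFL_at's integrand at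
`A' = (M+1)/(N+1)^{1/3}` for the admissible long-flight weight `h_L = 1_{IsLong A t_N} · h` (`measurable_longWt`, `abs_longWt_le_one`,
`longWt_eq_zero`). All helper lemmas are the public ones of `…MesoLongReduction` (nothing is re-declared). Purpose: the lead
specialises the per-profile reductions to CONSTANT profiles (`EquilibriumMesoBody rs` from `FarPairDecorrelationLongConst rs`).
-/

noncomputable section

open MeasureTheory Set Filter Topology
open scoped ENNReal Classical

namespace Summit.AtomisticToContinuum.HydrodynamicLimit.Theorems.KickFairRelEquilibriumMesoLine

open Literature.Analysis.FluidPDE Literature.MathematicalPhysics.KineticTheory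
open Summit.AtomisticToContinuum.HydrodynamicLimit.Theorems.KickFairRelEquilibriumMesoNegative
  (KickBoundRel MesoBody)

/-- **STUB `mesoBodyAt_of_long` — the per-profile reduction `B1_at → U_at → TFL_at → MesoBody_at` of the line
`kinetic-window-cut` (rev 5).** At fixed profiles `(a₀, θ₀, u₀)` (the continuity/positivity hypotheses are carried only to match
the shape of the global statements; the argument does not use them): given `Φ, τ, g (|g| ≤ C), δ` and admissible `h`, B1_at at
`δ/3` (`N₁`), U_at at `δ/(3(4C+1))` (giving `A` and `N₂`), TFL_at at `(A, δ/3)` (`N₃`); for `N ≥ max N₁ (max N₂ N₃)` split `S_h`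
(`lintegral_abs_fullSum_le_long` with `tw = t_N`): the bias term is B1_at's integrand, the short term is U_at's, and the long term is
bounded by `δ/3` through Fatou in the truncation level (`lintegral_abs_mul_sum_le_of_trunc`), each level-`(M+1)` truncation being
TFL_at's integrand at `A' = (M+1)/(N+1)^{1/3}` for the long-flight weight `h_L = 1_{IsLong A t_N} · h`.
`σ₀ := min (min σ₁ σ₂) (min σ₃ (1/2))`; `KickBoundRel … = ∫⁻ ofReal |fullSum …|` definitionally. Verbatim the main proof of the
landed global reduction `mesoBody_of_long` after its opening lines. [folklore] -/
theorem mesoBodyAt_of_long : ∀ (a₀ θ₀ : T3 → ℝ) (u₀ : T3 → V3), Continuous a₀ → Continuous θ₀ → Continuous u₀ →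
    (∀ x, 0 < a₀ x) → (∀ x, 0 < θ₀ x) →
    SingleKickBiasAt rs a₀ θ₀ u₀ → ShortFlightLGAt a₀ θ₀ u₀ → TruncatedFluctuationLongAt rs a₀ θ₀ u₀ →
      MesoBodyAt rs a₀ θ₀ u₀ := by
  intro a₀ θ₀ u₀ _ _ _ _ _ hB1 hU hTF
  obtain ⟨σ₁, hσ₁, H1⟩ := hB1
  obtain ⟨σ₂, hσ₂, H2⟩ := hU
  obtain ⟨σ₃, hσ₃, H3⟩ := hTF
  refine ⟨min (min σ₁ σ₂) (min σ₃ (1 / 2)), lt_min (lt_min hσ₁ hσ₂) (lt_min hσ₃ (by norm_num)), ?_⟩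
  intro σ hσ hσlt Φ τ hτ g hg hgb δ hδ
  have hσ1 : σ < σ₁ := hσlt.trans_le ((min_le_left _ _).trans (min_le_left _ _))
  have hσ2' : σ < σ₂ := hσlt.trans_le ((min_le_left _ _).trans (min_le_right _ _))
  have hσ3 : σ < σ₃ := hσlt.trans_le ((min_le_right _ _).trans (min_le_left _ _))
  have hσ12 : σ ≤ 1 / 2 := (hσlt.trans_le ((min_le_right _ _).trans (min_le_right _ _))).le
  obtain ⟨C, hC⟩ := hgb
  have hC0 : 0 ≤ C := (abs_nonneg _).trans (hC 0)
  have h4C1 : 0 < 4 * C + 1 := by positivity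
  obtain ⟨N₁, hN₁⟩ := H1 σ hσ hσ1 Φ τ hτ g hg ⟨C, hC⟩ (δ / 3) (by positivity)
  obtain ⟨A, hA, N₂, hN₂⟩ := H2 σ hσ hσ2' Φ τ hτ (δ / (3 * (4 * C + 1))) (by positivity)
  obtain ⟨N₃, hN₃⟩ := H3 σ hσ hσ3 Φ τ hτ g hg ⟨C, hC⟩ A hA (δ / 3) (by positivity)
  refine ⟨max N₁ (max N₂ N₃), fun N hN h hhm hhb => ?_⟩
  have hN1 : N₁ ≤ N := (le_max_left _ _).trans hN
  have hN2 : N₂ ≤ N := ((le_max_left _ _).trans (le_max_right _ _)).trans hN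
  have hN3 : N₃ ≤ N := ((le_max_right _ _).trans (le_max_right _ _)).trans hN
  -- the goal is the crux's let-chain; it is the local Gibbs mean of `fullSum`
  change ∫⁻ z, ENNReal.ofReal |fullSum (Φ N) τ (rs N) g h z| ∂(localGibbsLaw σ a₀ u₀ θ₀ N (Φ N)) ≤
    ENNReal.ofReal δ
  have h1 := hN₁ N hN1
  have h2 := hN₂ N hN2
  -- the long term: Fatou in the truncation level, each truncation bounded by TFL_at for the weight `h_L`
  have h3 : ∫⁻ z, ENNReal.ofReal |hsDiameter σ N / ((N : ℝ) + 1) *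
      ∑ i : Fin (N + 1), ∑ n ∈ Finset.range (cnt (Φ N) τ z i),
        ((if IsLong A (tN N) (past (Φ N) (rs N) z i n) then (1 : ℝ) else 0) * h i n (past (Φ N) (rs N) z i n) *
          (kickDev (Φ N) (rs N) g i n z - betaLG σ a₀ θ₀ u₀ (Φ N) (rs N) g i n z))|
        ∂(localGibbsLaw σ a₀ u₀ θ₀ N (Φ N)) ≤ ENNReal.ofReal (δ / 3) := by
    have hP : 0 < ((N : ℝ) + 1) ^ (1 / 3 : ℝ) := by positivity
    refine lintegral_abs_mul_sum_le_of_trunc (fun M => ?_) (fun M => ?_)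
    · exact aemeasurable_truncFn hσ (Φ N) a₀ θ₀ u₀ τ (rs N) hg (measurable_longWt A (tN N) hhm) _
    · have key := hN₃ N hN3 (((M : ℝ) + 1) / ((N : ℝ) + 1) ^ (1 / 3 : ℝ)) (by positivity)
        (fun i n p => (if IsLong A (tN N) p then (1 : ℝ) else 0) * h i n p)
        (measurable_longWt A (tN N) hhm) (abs_longWt_le_one A (tN N) hhb)
        (fun i n p hp => longWt_eq_zero A (tN N) h i n hp)
      rw [div_mul_cancel₀ _ hP.ne'] at key
      exact key
  have key : 4 * C * (δ / (3 * (4 * C + 1))) ≤ δ / 3 := by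
    have hq : 4 * C / (4 * C + 1) ≤ 1 := (div_le_one h4C1).2 (by linarith)
    calc 4 * C * (δ / (3 * (4 * C + 1))) = δ / 3 * (4 * C / (4 * C + 1)) := by
          field_simp
      _ ≤ δ / 3 * 1 := mul_le_mul_of_nonneg_left hq (by positivity)
      _ = δ / 3 := mul_one _
  calc ∫⁻ z, ENNReal.ofReal |fullSum (Φ N) τ (rs N) g h z| ∂(localGibbsLaw σ a₀ u₀ θ₀ N (Φ N))
      ≤ _ := lintegral_abs_fullSum_le_long hσ hσ12 (Φ N) a₀ θ₀ u₀ τ (rs N) hC hhb A (tN N)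
    _ ≤ ENNReal.ofReal (δ / 3) + ENNReal.ofReal (δ / 3) +
          ENNReal.ofReal (4 * C) * ENNReal.ofReal (δ / (3 * (4 * C + 1))) :=
        add_le_add (add_le_add h1 h3) (mul_le_mul_right h2 _)
    _ = ENNReal.ofReal (δ / 3 + δ / 3 + 4 * C * (δ / (3 * (4 * C + 1)))) := by
        rw [← ENNReal.ofReal_mul (by positivity), ← ENNReal.ofReal_add (by positivity) (by positivity),
          ← ENNReal.ofReal_add (by positivity) (by positivity)]
    _ ≤ ENNReal.ofReal δ := ENNReal.ofReal_le_ofReal (by linarith)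

end Summit.AtomisticToContinuum.HydrodynamicLimit.Theorems.KickFairRelEquilibriumMesoLine

end
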